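import Literature.NumberTheory.EllipticCurves.LocalPointsModKernelOfReductionMultiplicativeProofs
import Literature.NumberTheory.EllipticCurves.TateCurve.MultiplicativeTwistUnramifiedProofs
import Literature.NumberTheory.EllipticCurves.KodairaNeronUnramifiedInertiaProofs
import Literature.NumberTheory.EllipticCurves.FramedTateGaloisRep
import Literature.NumberTheory.GaloisRepresentations.OrdinaryGaloisRep
import HarnessLib

/-!
# STUB-IDEAS `stub_liftFive` — ideator k = 3 (FAMILY 3, PROBE THE EXTREMES), GEN 9 companion

Crux `Summit.ABC.ABC.Theses.DefiniteXi.FreyModularity` (stmt-ABC-11340), skeleton `Lines/Sketch.lean`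
(sha 21576c53), stub `stub_liftFive` (Diamond 1996 Thm 5.3 = `CDT_theorem_7_2_2 ∩ {25 ∤ N}`; consumed
once, on a Frey curve MULTIPLICATIVE at `5`).

GEN 9 = EXTREMAL MINIMISATION of the local debt of the multiplicative-ordinary corner (gens 6–8).
Gen 8 ported the `p = 3` COUNT `#Fil_v E[p^k] = p^k` as an 8-lemma F-series (B1ℓ … T1) to reach
gen-7's L1 `#E₁(K̄_v)[pⁿ] = pⁿ`, and left L7 (inertia trivial on `E[p^∞]` mod `E₁`) and the frame
lemma A3 (M-sized) sorried.  Probing the extreme: at a multiplicative `v ∣ p` the Tate datum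
`(q, Ψ)` (`ker Ψ = q^ℤ`, `E₁ = Ψ(1 + 𝔪)`) makes `E₁[pⁿ]` LITERALLY `Ψ(μ_{pⁿ})` — no filtration count,
no induction, no transport to `E(K̄)` — and the tree ALREADY proves `#φ(μ_l) = l` for any
`q^ℤ`-uniformisation (`TateCurve.exists_subgroup_coe_eq_image_rootsOfUnity`, [GenEll] Lemma 3.2:
`Set.InjOn` on `μ_l` + `HasEnoughRootsOfUnity.natCard_rootsOfUnity`).  So BOTH open inputs of P2
factor through ONE S-sized membership lemma M3 (`P ∈ E₁ ∧ pⁿP = 0 ↔ P = Ψ(u), u^{pⁿ} = 1`) plus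
three XS lemmas copied from tree proofs (M0, M1, M2), and L7 is M3(←) applied to `u' = τu/u`.
A3 is cut into three `LinearMap.toMatrix` one-liners (A3b) + a basis-through-a-line lemma (A3a) +
the frame transport (A3c).  Every `sorry` below is ≤ one prover cycle; the two ASSEMBLIES
(L1 from M2/M3/M3b; L7 from M4 + the datum) are PROVED here, so the cut is kernel-certified.

TALLY (`lean check --no-snap`, rc 0, ONE `sorry`): PROVED here — M0, M1, M2, M3, M3b, M4, hence the
gen-7 targets **L1 and L7 SORRY-FREE** (`#print axioms l1Statement_holds / l7Statement_holds` =
propext, Classical.choice, Quot.sound), A3a, A3b-i/ii/iii, two `rfl` shape checks; the only `sorry`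
left is A3c (S, the frame transport).  With gen 7's proved `multiplicativeOrdinaryFiltration_of_L1_L7`
(P2) and gen 8's proved `ordinaryWeightTwoAtFive_of_P2` (P2′ modulo A3), the local side of the
corner is reduced to A3c alone.

Datum-parametric style (hypotheses `hq0 hq1 Ψ hker hiff`, as the tree's
`mem_localKernelOfReduction_iff_exists_zpow_of_tate`): each lemma is independent of how the datum
is obtained (`TateCurve.exists_twistedTateUniformisation_localKernelOfReduction_iff`).
Literature-only imports (`lean check` on the farm snapshot).  Target files for provers:
`Literature/NumberTheory/EllipticCurves/TateUniformisationPPowerTorsionProofs.lean` (§1–§2) and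
`Literature/NumberTheory/EllipticCurves/OrdinaryFrameOfStableLineProofs.lean` (§3),
`--supports stmt-ABC-11340`.
-/

noncomputable section

open scoped Classical NNReal NumberField AddSubgroup
open NumberField IsDedekindDomain Field
open Literature.NumberTheory.EllipticCurves Literature.NumberTheory.EllipticCurves.TateCurve
open Literature.NumberTheory.GaloisRepresentations
open WeierstrassCurve IsDedekindDomain.HeightOneSpectrum

namespace Summit.ABC.ABC.Cruxes.FreyModularity.StubIdeas.LiftFive3g9

/-! ## §1 The μ-road: `E₁(K̄_v)[pⁿ] = Ψ(μ_{pⁿ})` for Tate data `(q, Ψ)` at a multiplicative `v ∣ p` -/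

section MuRoad

variable {K : Type} [Field K] [NumberField K] (W : WeierstrassCurve K) [W.IsElliptic]
  (v : HeightOneSpectrum (𝓞 K)) {p : ℕ} [hp : Fact p.Prime]

/-- **M0 (XS) — PROVED.** `|q^m| = 1` in `K̄_v` forces `m = 0` when `0 < |q| < 1` (valuation form of the tree's
`TateCurve.zpow_algebraMap_eq_one_iff`; bridge `coe_spectralValuation_algebraMap` /
`spectralValuation_algebraMap_lt_one_of_mem_maximalIdeal`). [cite: SilvermanATAEC1994, Thm. V.3.1 (d) (proof, PDF p. 399)] -/
theorem eq_zero_of_spectralValuation_zpow_eq_one {q : v.adicCompletion K} (hq0 : q ≠ 0)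
    (hq1 : Valued.v q < 1) {m : ℤ}
    (hm : v.spectralValuation
      (algebraMap (v.adicCompletion K) (AlgebraicClosure (v.adicCompletion K)) q ^ m) = 1) :
    m = 0 := by
  set x := v.spectralValuation
    (algebraMap (v.adicCompletion K) (AlgebraicClosure (v.adicCompletion K)) q) with hxdef
  have hx0 : 0 < x := by
    rw [hxdef, Valuation.pos_iff]
    exact (map_ne_zero (algebraMap _ _)).mpr hq0
  have hx1 : x < 1 := by
    rw [hxdef, ← NNReal.coe_lt_coe, coe_spectralValuation_algebraMap v.coe_spectralValuation,
      NNReal.coe_one, Valued.toNormedField.norm_lt_one_iff]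
    exact hq1
  rw [map_zpow₀] at hm
  exact (zpow_eq_one_iff_right₀ hx0.le hx1.ne).mp hm

omit [W.IsElliptic] in
/-- **M1 (XS, tree-verbatim) — PROVED.** `Ψ` is injective on `μ_l(K̄_v)`: `Ψ(u) = Ψ(u')`, `u^l = u'^l = 1` ⇒
`u/u' ∈ q^ℤ ∩ μ_l = 1`.  Verbatim the `hinj` block of `TateCurve.exists_subgroup_coe_eq_image_rootsOfUnity`
(there over a normed field; here `|·| = v.spectralValuation`, M0). [cite: MochizukiGenEll2010, §3 Lem 3.2 p.15]
[cite: SilvermanATAEC1994, Thm. V.3.1 (c),(d)] -/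
theorem injOn_tate_pow_eq_one {q : v.adicCompletion K} (hq0 : q ≠ 0) (hq1 : Valued.v q < 1)
    (Ψ : Additive (AlgebraicClosure (v.adicCompletion K))ˣ →+ localPoints W (v.adicCompletion K))
    (hker : ∀ u : (AlgebraicClosure (v.adicCompletion K))ˣ, Ψ (Additive.ofMul u) = 0 ↔
      ∃ n : ℤ, (u : AlgebraicClosure (v.adicCompletion K)) =
        algebraMap (v.adicCompletion K) (AlgebraicClosure (v.adicCompletion K)) q ^ n)
    {l : ℕ} (hl : 0 < l) :
    Set.InjOn (fun u : (AlgebraicClosure (v.adicCompletion K))ˣ ↦ Ψ (Additive.ofMul u))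
      {u | u ^ l = 1} := by
  -- verbatim the `hinj` block of `TateCurve.exists_subgroup_coe_eq_image_rootsOfUnity`
  have hq : ‖q‖ < 1 := Valued.toNormedField.norm_lt_one_iff.mpr hq1
  set qb : AlgebraicClosure (v.adicCompletion K) :=
    algebraMap (v.adicCompletion K) (AlgebraicClosure (v.adicCompletion K)) q with hqb_def
  intro u hu u' hu' huu'
  have hu1 : u ^ l = 1 := hu
  have hu1' : u' ^ l = 1 := hu'
  have huv' : Ψ (Additive.ofMul u) = Ψ (Additive.ofMul u') := huu'
  have h0 : Ψ (Additive.ofMul (u * u'⁻¹)) = 0 := by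
    rw [ofMul_mul, ofMul_inv, map_add, map_neg, huv', add_neg_cancel]
  obtain ⟨n, hn⟩ := (hker _).mp h0
  have hnl : (fun k : ℤ ↦ algebraMap (v.adicCompletion K) (AlgebraicClosure (v.adicCompletion K)) q ^ k)
      (n * l) =
      (fun k : ℤ ↦ algebraMap (v.adicCompletion K) (AlgebraicClosure (v.adicCompletion K)) q ^ k) 0 := by
    show qb ^ (n * l) = qb ^ (0 : ℤ)
    rw [zpow_zero, zpow_mul, zpow_natCast, ← hn, ← Units.val_pow_eq_pow_val, mul_pow, hu1, inv_pow,
      hu1', inv_one, mul_one, Units.val_one]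
  have hnl' : n * l = 0 := TateCurve.zpow_algebraMap_injective hq0 hq hnl
  have hn0 : n = 0 := by
    rcases mul_eq_zero.mp hnl' with h | h
    · exact h
    · exact absurd (by exact_mod_cast h : l = 0) hl.ne'
  rw [hn0, zpow_zero] at hn
  exact mul_inv_eq_one.mp (Units.ext hn)

omit [W.IsElliptic] in
/-- **M2 (XS, tree-verbatim) — PROVED.** `#Ψ(μ_l(K̄_v)) = l`: M1 + `Set.InjOn.ncard_image` +
`HasEnoughRootsOfUnity.natCard_rootsOfUnity` (`K̄_v` algebraically closed of characteristic `0`) —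
verbatim the cardinality block of `TateCurve.exists_subgroup_coe_eq_image_rootsOfUnity`.
[cite: MochizukiGenEll2010, §3 Lem 3.2 p.15] -/
theorem ncard_image_tate_pow_eq_one {q : v.adicCompletion K} (hq0 : q ≠ 0) (hq1 : Valued.v q < 1)
    (Ψ : Additive (AlgebraicClosure (v.adicCompletion K))ˣ →+ localPoints W (v.adicCompletion K))
    (hker : ∀ u : (AlgebraicClosure (v.adicCompletion K))ˣ, Ψ (Additive.ofMul u) = 0 ↔
      ∃ n : ℤ, (u : AlgebraicClosure (v.adicCompletion K)) =
        algebraMap (v.adicCompletion K) (AlgebraicClosure (v.adicCompletion K)) q ^ n)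
    {l : ℕ} (hl : 0 < l) :
    ((fun u : (AlgebraicClosure (v.adicCompletion K))ˣ ↦ Ψ (Additive.ofMul u)) '' {u | u ^ l = 1}).ncard
      = l := by
  -- verbatim the cardinality block of `TateCurve.exists_subgroup_coe_eq_image_rootsOfUnity`
  haveI : NeZero l := ⟨hl.ne'⟩
  haveI : CharZero (v.adicCompletion K) :=
    charZero_of_injective_algebraMap (algebraMap K (v.adicCompletion K)).injective
  haveI : CharZero (AlgebraicClosure (v.adicCompletion K)) := charZero_of_injective_algebraMap
    (algebraMap (v.adicCompletion K) (AlgebraicClosure (v.adicCompletion K))).injective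
  haveI : NeZero (l : v.adicCompletion K) := ⟨Nat.cast_ne_zero.mpr hl.ne'⟩
  haveI : NeZero (l : AlgebraicClosure (v.adicCompletion K)) := ⟨Nat.cast_ne_zero.mpr hl.ne'⟩
  have hE : ({u : (AlgebraicClosure (v.adicCompletion K))ˣ | u ^ l = 1} : Set _) =
      (rootsOfUnity l (AlgebraicClosure (v.adicCompletion K)) : Set _) := by
    ext u
    simp [mem_rootsOfUnity]
  rw [(injOn_tate_pow_eq_one W v hq0 hq1 Ψ hker hl).ncard_image, hE, ← Nat.card_coe_set_eq]
  exact HasEnoughRootsOfUnity.natCard_rootsOfUnity (AlgebraicClosure (v.adicCompletion K)) l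

omit [W.IsElliptic] in
/-- **M3 (S) — the extremal description of `E₁[pⁿ]` — PROVED.** For Tate data `(q, Ψ)` with `ker Ψ = q^ℤ` and
`E₁ = Ψ(1 + 𝔪)` at a place `v ∣ p`: `P ∈ E₁(K̄_v)` with `pⁿ P = O` iff `P = Ψ(u)` with `u^{pⁿ} = 1`.
(→) `P = Ψ(u)`, `u` a principal unit; `Ψ(u^{pⁿ}) = pⁿP = O` gives `u^{pⁿ} = q^m`, and `|u| = 1` gives
`|q^m| = 1`, so `m = 0` (M0).  (←) `|u|^{pⁿ} = 1 ⇒ |u| = 1`, and `u^{pⁿ} - 1 = 0` is "principal", so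
`u` is a principal unit (`WeierstrassCurve.spectralValuation_sub_one_lt_one_of_pow`), i.e. `Ψ(u) ∈ E₁`;
`pⁿ Ψ(u) = Ψ(u^{pⁿ}) = Ψ(1) = O`.  [cite: SilvermanATAEC1994, §V.4 (PDF pp. 399–401), Thm. V.5.3]
[cite: SerreLocalFields1979, Ch. IV §4 Prop. 17] -/
theorem mem_localKernelOfReduction_and_nsmul_eq_zero_iff_of_tate
    (hpv : ((p : ℕ) : 𝓞 K) ∈ v.asIdeal) {q : v.adicCompletion K} (hq0 : q ≠ 0) (hq1 : Valued.v q < 1)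
    (Ψ : Additive (AlgebraicClosure (v.adicCompletion K))ˣ →+ localPoints W (v.adicCompletion K))
    (hker : ∀ u : (AlgebraicClosure (v.adicCompletion K))ˣ, Ψ (Additive.ofMul u) = 0 ↔
      ∃ n : ℤ, (u : AlgebraicClosure (v.adicCompletion K)) =
        algebraMap (v.adicCompletion K) (AlgebraicClosure (v.adicCompletion K)) q ^ n)
    (hiff : ∀ P : localPoints W (v.adicCompletion K), P ∈ W.localKernelOfReduction v ↔
      ∃ u : (AlgebraicClosure (v.adicCompletion K))ˣ,
        v.spectralValuation ((u : AlgebraicClosure (v.adicCompletion K)) - 1) < 1 ∧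
          Ψ (Additive.ofMul u) = P)
    (n : ℕ) (P : localPoints W (v.adicCompletion K)) :
    (P ∈ W.localKernelOfReduction v ∧ p ^ n • P = 0) ↔
      ∃ u : (AlgebraicClosure (v.adicCompletion K))ˣ, u ^ p ^ n = 1 ∧ Ψ (Additive.ofMul u) = P := by
  -- a principal unit is a unit
  have unit_of_principal : ∀ {x : AlgebraicClosure (v.adicCompletion K)},
      v.spectralValuation (x - 1) < 1 → v.spectralValuation x = 1 := by
    intro x hx
    have h := Valuation.map_add_eq_of_lt_left v.spectralValuation
      (x := (1 : AlgebraicClosure (v.adicCompletion K))) (y := x - 1) (by rw [map_one]; exact hx)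
    rwa [map_one, add_sub_cancel] at h
  constructor
  · rintro ⟨hP, hpn⟩
    obtain ⟨u, hu1, huP⟩ := (hiff P).mp hP
    -- `Ψ(u^{pⁿ}) = pⁿ P = 0`, so `u^{pⁿ} = q^m`
    have h0 : Ψ (Additive.ofMul (u ^ p ^ n)) = 0 := by
      rw [ofMul_pow, map_nsmul, huP, hpn]
    obtain ⟨m, hm⟩ := (hker _).mp h0
    -- `|u| = 1` forces `|q^m| = 1`, hence `m = 0` (M0)
    have hu_one : v.spectralValuation (u : AlgebraicClosure (v.adicCompletion K)) = 1 :=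
      unit_of_principal hu1
    have hqm : v.spectralValuation
        (algebraMap (v.adicCompletion K) (AlgebraicClosure (v.adicCompletion K)) q ^ m) = 1 := by
      rw [← hm, Units.val_pow_eq_pow_val, map_pow, hu_one, one_pow]
    have hm0 : m = 0 := eq_zero_of_spectralValuation_zpow_eq_one v hq0 hq1 hqm
    refine ⟨u, Units.ext ?_, huP⟩
    rw [hm, hm0, zpow_zero, Units.val_one]
  · rintro ⟨u, hupn, rfl⟩
    -- `|u|^{pⁿ} = 1 ⇒ |u| = 1`, and `u^{pⁿ} = 1` is principal, so `u` is a principal unit (`v ∣ p`)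
    have hu_one : v.spectralValuation (u : AlgebraicClosure (v.adicCompletion K)) = 1 := by
      have h : v.spectralValuation (u : AlgebraicClosure (v.adicCompletion K)) ^ p ^ n = 1 := by
        rw [← map_pow, ← Units.val_pow_eq_pow_val, hupn, Units.val_one, map_one]
      exact (pow_eq_one_iff_of_nonneg zero_le (pow_ne_zero n hp.out.ne_zero)).mp h
    have hprin : v.spectralValuation ((u : AlgebraicClosure (v.adicCompletion K)) - 1) < 1 := by
      refine spectralValuation_sub_one_lt_one_of_pow hpv n hu_one ?_
      rw [← Units.val_pow_eq_pow_val, hupn, Units.val_one, sub_self, map_zero]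
      exact one_pos
    refine ⟨(hiff _).mpr ⟨u, hprin, rfl⟩, ?_⟩
    rw [← map_nsmul, ← ofMul_pow, hupn, ofMul_one, map_zero]

omit [W.IsElliptic] hp in
/-- **M3b (XS, bookkeeping) — PROVED.** The `pⁿ`-torsion of the subgroup `E₁(K̄_v)` counted inside
`E(K̄_v)`. [folklore] -/
theorem natCard_torsionBy_localKernelOfReduction_eq_ncard (n : ℕ) :
    Nat.card ((W.localKernelOfReduction v)[(p ^ n : ℕ)]) =
      ({P : localPoints W (v.adicCompletion K) |
        P ∈ W.localKernelOfReduction v ∧ p ^ n • P = 0}).ncard := by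
  classical
  rw [← Nat.card_coe_set_eq]
  refine Nat.card_congr ?_
  refine
    { toFun := fun x =>
        ⟨((x : W.localKernelOfReduction v) : localPoints W (v.adicCompletion K)),
          (x : W.localKernelOfReduction v).2, ?_⟩
      invFun := fun P => ⟨⟨P.1, P.2.1⟩, ?_⟩
      left_inv := fun x => rfl
      right_inv := fun P => rfl }
  · have h := AddSubgroup.torsionBy.nsmul_iff.mp x.2
    have h' := congrArg Subtype.val h
    rwa [AddSubmonoidClass.coe_nsmul, ZeroMemClass.coe_zero] at h'
  · apply AddSubgroup.torsionBy.nsmul_iff.mpr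
    apply Subtype.ext
    simpa using P.2.2

omit [W.IsElliptic] in
/-- **M4 (XS) — the core of L7 — PROVED (from M3 ←).** If `Ψ` is `τ`-equivariant and `u^{pⁿ} ∈ q^ℤ`, then
`τ • Ψ(u) - Ψ(u) = Ψ(τu/u) ∈ E₁(K̄_v)`: `(τu/u)^{pⁿ} = τ(q^m)/q^m = 1` (`q^m ∈ K_v` is fixed by `τ`,
`AlgEquiv.commutes`), then M3 (←). [cite: SilvermanATAEC1994, Lemma V.5.2 (c), Thm. V.5.3 (PDF pp. 407–410)] -/
theorem smul_sub_mem_localKernelOfReduction_of_tate_equivariant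
    (hpv : ((p : ℕ) : 𝓞 K) ∈ v.asIdeal) {q : v.adicCompletion K} (hq0 : q ≠ 0) (hq1 : Valued.v q < 1)
    (Ψ : Additive (AlgebraicClosure (v.adicCompletion K))ˣ →+ localPoints W (v.adicCompletion K))
    (hker : ∀ u : (AlgebraicClosure (v.adicCompletion K))ˣ, Ψ (Additive.ofMul u) = 0 ↔
      ∃ n : ℤ, (u : AlgebraicClosure (v.adicCompletion K)) =
        algebraMap (v.adicCompletion K) (AlgebraicClosure (v.adicCompletion K)) q ^ n)
    (hiff : ∀ P : localPoints W (v.adicCompletion K), P ∈ W.localKernelOfReduction v ↔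
      ∃ u : (AlgebraicClosure (v.adicCompletion K))ˣ,
        v.spectralValuation ((u : AlgebraicClosure (v.adicCompletion K)) - 1) < 1 ∧
          Ψ (Additive.ofMul u) = P)
    {τ : absoluteGaloisGroup (v.adicCompletion K)}
    (hτΨ : ∀ u : (AlgebraicClosure (v.adicCompletion K))ˣ,
      τ • Ψ (Additive.ofMul u) =
        Ψ (Additive.ofMul (Units.map
          (absoluteGaloisGroup.toAlgEquiv (v.adicCompletion K) τ :
            AlgebraicClosure (v.adicCompletion K) →* AlgebraicClosure (v.adicCompletion K)) u)))
    {n : ℕ} {u : (AlgebraicClosure (v.adicCompletion K))ˣ}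
    (hu : ∃ m : ℤ, ((u ^ p ^ n : (AlgebraicClosure (v.adicCompletion K))ˣ) :
        AlgebraicClosure (v.adicCompletion K)) =
      algebraMap (v.adicCompletion K) (AlgebraicClosure (v.adicCompletion K)) q ^ m) :
    τ • Ψ (Additive.ofMul u) - Ψ (Additive.ofMul u) ∈ W.localKernelOfReduction v := by
  obtain ⟨m, hm⟩ := hu
  set σ := absoluteGaloisGroup.toAlgEquiv (v.adicCompletion K) τ with hσ
  set u' : (AlgebraicClosure (v.adicCompletion K))ˣ :=
    Units.map (σ : AlgebraicClosure (v.adicCompletion K) →* AlgebraicClosure (v.adicCompletion K)) u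
    with hu'
  have hrew : τ • Ψ (Additive.ofMul u) - Ψ (Additive.ofMul u) =
      Ψ (Additive.ofMul (u' * u⁻¹)) := by
    rw [hτΨ u, ofMul_mul, ofMul_inv, map_add, map_neg, sub_eq_add_neg]
  -- `(τu/u)^{pⁿ} = τ(q^m)/q^m = 1`
  have hpow : (u' * u⁻¹) ^ p ^ n = 1 := by
    rw [mul_pow, inv_pow, mul_inv_eq_one]
    refine Units.ext ?_
    rw [hu', ← map_pow, Units.coe_map, MonoidHom.coe_coe, hm, map_zpow₀, AlgEquiv.commutes]
  have key := (mem_localKernelOfReduction_and_nsmul_eq_zero_iff_of_tate W v hpv hq0 hq1 Ψ hker hiff n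
    (Ψ (Additive.ofMul (u' * u⁻¹)))).mpr ⟨u' * u⁻¹, hpow, rfl⟩
  rw [hrew]
  exact key.1

/-- **L1 (gen-7 signature VERBATIM) — PROVED (M2 + M3 + M3b; sorry-free).** `#E₁(K̄_v)[pⁿ] = pⁿ`
at a multiplicative `v ∣ p`. [cite: SilvermanATAEC1994, §V.4 (PDF pp. 399–401), Thm. V.5.3] -/
theorem natCard_torsionBy_localKernelOfReduction_eq (hpv : ((p : ℕ) : 𝓞 K) ∈ v.asIdeal)
    (hmult : W.HasMultiplicativeReductionAt v) (n : ℕ) :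
    Nat.card ((W.localKernelOfReduction v)[(p ^ n : ℕ)]) = p ^ n := by
  obtain ⟨q, t, Ψ, hq0, hq1, -, -, -, hker, -, hiff⟩ :=
    exists_twistedTateUniformisation_localKernelOfReduction_iff W v hmult
  rw [natCard_torsionBy_localKernelOfReduction_eq_ncard W v n]
  have hset : ({P : localPoints W (v.adicCompletion K) |
        P ∈ W.localKernelOfReduction v ∧ p ^ n • P = 0}) =
      (fun u : (AlgebraicClosure (v.adicCompletion K))ˣ ↦ Ψ (Additive.ofMul u)) ''
        {u | u ^ p ^ n = 1} := by
    ext P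
    rw [Set.mem_setOf_eq, Set.mem_image,
      mem_localKernelOfReduction_and_nsmul_eq_zero_iff_of_tate W v hpv hq0 hq1 Ψ hker hiff n P]
    simp only [Set.mem_setOf_eq]
  rw [hset]
  exact ncard_image_tate_pow_eq_one W v hq0 hq1 Ψ hker (pow_pos hp.out.pos n)

/-- **L7 (gen-7 statement VERBATIM, RENAMED** — the tree already has
`smul_sub_mem_localKernelOfReduction_of_mem_absInertia` for GOOD reduction in
`LocalPointsOrdinaryKummerCongruenceProofs`) — **PROVED from M4 + gen-8 S0 (inlined); sorry-free.**
At a multiplicative `v ∣ p` the inertia group acts trivially on `E(K̄_v)[p^∞]` modulo `E₁(K̄_v)`.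
[cite: SilvermanATAEC1994, Lemma V.5.2 (c), Thm. V.5.3 (PDF pp. 407–410)] -/
theorem smul_sub_mem_localKernelOfReduction_of_mem_absInertia_of_hasMultiplicativeReductionAt
    (hpv : ((p : ℕ) : 𝓞 K) ∈ v.asIdeal) (hmult : W.HasMultiplicativeReductionAt v)
    {τ : absoluteGaloisGroup (v.adicCompletion K)} (hτ : τ ∈ absInertia (v.adicCompletion K))
    {n : ℕ} {Q : localPoints W (v.adicCompletion K)} (hQ : p ^ n • Q = 0) :
    τ • Q - Q ∈ W.localKernelOfReduction v := by
  obtain ⟨q, t, Ψ, hq0, hq1, -, ht, hsurj, hker, hΨσ, hiff⟩ :=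
    exists_twistedTateUniformisation_localKernelOfReduction_iff W v hmult
  obtain ⟨w, hw⟩ := v.exists_spectralValuation
  obtain ⟨𝔐, h𝔐⟩ := v.localPrimesAbove_nonempty
  have hτ' : τ ∈ 𝔐.inertia (absoluteGaloisGroup (v.adicCompletion K)) := by
    rw [inertia_eq_absInertia hw h𝔐]; exact hτ
  have hτt : absoluteGaloisGroup.toAlgEquiv (v.adicCompletion K) τ t = t :=
    toAlgEquiv_eq_of_mem_inertia_of_sq_eq_gamma W hmult h𝔐 ht hτ'
  have hτΨ : ∀ u : (AlgebraicClosure (v.adicCompletion K))ˣ,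
      τ • Ψ (Additive.ofMul u) =
        Ψ (Additive.ofMul (Units.map
          (absoluteGaloisGroup.toAlgEquiv (v.adicCompletion K) τ :
            AlgebraicClosure (v.adicCompletion K) →* AlgebraicClosure (v.adicCompletion K)) u)) := by
    intro u
    rw [hΨσ τ u, if_pos hτt, one_zsmul]
  obtain ⟨x, rfl⟩ := hsurj Q
  have h0 : Ψ (Additive.ofMul ((Additive.toMul x) ^ p ^ n)) = 0 := by
    rw [ofMul_pow, ofMul_toMul, map_nsmul, hQ]
  obtain ⟨m, hm⟩ := (hker _).mp h0
  have key := smul_sub_mem_localKernelOfReduction_of_tate_equivariant W v hpv hq0 hq1 Ψ hker hiff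
    hτΨ (n := n) (u := Additive.toMul x) ⟨m, hm⟩
  simpa only [ofMul_toMul] using key

end MuRoad

/-! ## §2 The gen-7 currency: L1/L7 as named facts ⇒ P2 (gen 7's PROVED `multiplicativeOrdinaryFiltration_of_L1_L7`) -/

/-- gen-7 `L1Statement` (verbatim). -/
def L1Statement : Prop :=
  ∀ {K : Type} [Field K] [NumberField K] (W : WeierstrassCurve K) [W.IsElliptic]
    (p : ℕ) [Fact p.Prime] (v : HeightOneSpectrum (𝓞 K)),
    ((p : ℕ) : 𝓞 K) ∈ v.asIdeal → W.HasMultiplicativeReductionAt v →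
    ∀ n : ℕ, Nat.card ((W.localKernelOfReduction v)[(p ^ n : ℕ)]) = p ^ n

/-- gen-7 `L7Statement` (verbatim). -/
def L7Statement : Prop :=
  ∀ {K : Type} [Field K] [NumberField K] (W : WeierstrassCurve K) [W.IsElliptic]
    (p : ℕ) [Fact p.Prime] (v : HeightOneSpectrum (𝓞 K)),
    ((p : ℕ) : 𝓞 K) ∈ v.asIdeal → W.HasMultiplicativeReductionAt v →
    ∀ τ ∈ absInertia (v.adicCompletion K), ∀ (n : ℕ) (Q : localPoints W (v.adicCompletion K)),
      p ^ n • Q = 0 → τ • Q - Q ∈ W.localKernelOfReduction v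

/-- **L1 holds** — sorry-free. [folklore] -/
theorem l1Statement_holds : L1Statement := by
  intro K _ _ W _ p _ v hpv hmult n
  exact natCard_torsionBy_localKernelOfReduction_eq W v hpv hmult n

/-- **L7 holds** — sorry-free. [folklore] -/
theorem l7Statement_holds : L7Statement := by
  intro K _ _ W _ p _ v hpv hmult τ hτ n Q hQ
  exact smul_sub_mem_localKernelOfReduction_of_mem_absInertia_of_hasMultiplicativeReductionAt W v hpv
    hmult hτ hQ

/-! ## §3 A3 cut into one-liners: basis through the stable line, three matrix entries, frame transport -/

section FrameLA

variable {R M : Type*} [CommRing R] [AddCommGroup M] [Module R M]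

/-- **A3b-i (XS, Mathlib-only) — PROVED.** If `f` maps `b₀` into the line `R b₀` then the `(1,0)` entry of
`[f]_b` vanishes (`LinearMap.toMatrix_apply`: `[f]_b i j = b.repr (f (b j)) i`). [folklore] -/
theorem toMatrix_one_zero_eq_zero_of_map_mem_span (b : Module.Basis (Fin 2) R M) (f : M →ₗ[R] M)
    (hf : f (b 0) ∈ Submodule.span R {b 0}) : LinearMap.toMatrix b b f 1 0 = 0 := by
  obtain ⟨c, hc⟩ := Submodule.mem_span_singleton.mp hf
  simp [LinearMap.toMatrix_apply, ← hc]

/-- **A3b-ii (XS, Mathlib-only) — PROVED.** If `f b₀ = c • b₀` then `[f]_b 0 0 = c`. [folklore] -/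
theorem toMatrix_zero_zero_eq_of_map_eq_smul (b : Module.Basis (Fin 2) R M) (f : M →ₗ[R] M)
    {c : R} (hf : f (b 0) = c • b 0) : LinearMap.toMatrix b b f 0 0 = c := by
  simp [LinearMap.toMatrix_apply, hf]

/-- **A3b-iii (XS, Mathlib-only) — PROVED.** If `f b₁ - b₁ ∈ R b₀` then `[f]_b 1 1 = 1`. [folklore] -/
theorem toMatrix_one_one_eq_one_of_map_sub_mem_span (b : Module.Basis (Fin 2) R M) (f : M →ₗ[R] M)
    (hf : f (b 1) - b 1 ∈ Submodule.span R {b 0}) : LinearMap.toMatrix b b f 1 1 = 1 := by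
  obtain ⟨c, hc⟩ := Submodule.mem_span_singleton.mp hf
  have h1 : f (b 1) = c • b 0 + b 1 := by rw [← sub_eq_iff_eq_add, ← hc]
  simp [LinearMap.toMatrix_apply, h1]

/-- **A3a (XS/S, Mathlib-only) — PROVED.** A line `L` in a plane `V` is spanned by the first vector of some
basis of `V` (`Basis.extend` of a non-zero `ℓ ∈ L`, reindexed by `Fin 2`). [folklore] -/
theorem exists_basis_fin_two_through_line {F V : Type*} [Field F] [AddCommGroup V] [Module F V]
    (hV : Module.finrank F V = 2) (L : Submodule F V) (hL : Module.finrank F L = 1) :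
    ∃ b : Module.Basis (Fin 2) F V, b 0 ∈ L ∧ ∀ x ∈ L, ∃ c : F, x = c • b 0 := by
  classical
  -- a generator of the line
  obtain ⟨x₀, hx₀ne, hx₀gen⟩ := finrank_eq_one_iff'.mp hL
  have hx₀V : (x₀ : V) ≠ 0 := fun h => hx₀ne (Subtype.ext h)
  -- extend it to a basis of `V` (`![x₀, y]`, then `basisOfLinearIndependentOfCardEqFinrank`)
  obtain ⟨y, hli⟩ := exists_linearIndependent_pair_of_one_lt_finrank (R := F) (by omega) hx₀V
  refine ⟨basisOfLinearIndependentOfCardEqFinrank hli (by simp [hV]), ?_, ?_⟩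
  · simp
  · intro x hx
    obtain ⟨c, hc⟩ := hx₀gen ⟨x, hx⟩
    refine ⟨c, ?_⟩
    have hc' := congrArg Subtype.val hc
    simp only [SetLike.val_smul] at hc'
    simp [← hc']

end FrameLA

section Frame

variable {K : Type} [Field K] [NumberField K] (W : WeierstrassCurve K) [W.IsElliptic]
  (v : HeightOneSpectrum (𝓞 K)) (p : ℕ) [hp : Fact p.Prime]

/-- **A3c (S) — gen-8 A3 signature VERBATIM, now over A3a/A3b.** Recipe: A3a
(`finrank_rationalTateModule_eq_two_holds`) gives `b` with `b 0` spanning `L`;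
`exists_conj_framedTateGaloisRep_eq_ofBasis` + `isOrdinaryOfWeightAt_conj_iff` move the goal to
`W.framedTateGaloisRepOfBasis p _ b`; take `Q := 1` in `isOrdinaryOfWeightAt_iff`; by
`FramedGaloisRep.toLocal_apply` + `coe_framedTateGaloisRepOfBasis_apply` + `Matrix.map_apply` the
three entries are the `algebraMap ℚ_[p] ℚ̄_p`-images of A3b-i (from `hst`), A3b-ii (from `hχ`, the
scalar `((χ_p τ : ℤ_[p]ˣ) : ℤ_[p]) : ℚ_[p]`; `IsScalarTower ℤ_[p] ℚ_[p] (PadicAlgCl p)` for the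
`algebraMap ℤ_[p]` form) and A3b-iii (from `hquot`); exponents `m = 1`, `(k-1)m = 1` by `pow_one`.
(`rationalTateGaloisRepOf (geomPoints W) p h σ = W.rationalGaloisRepTate p σ` is `rfl`.)
[cite: SkinnerWiles1999, §1 Theorem (ii)] [cite: Greenberg1991, §2 (p. 214)] -/
theorem isOrdinaryOfWeightAt_two_one_of_stableLine
    (L : Submodule ℚ_[p] (W.rationalTateModule p)) (hL1 : Module.finrank ℚ_[p] L = 1)
    (hst : ∀ (τ : absoluteGaloisGroup (v.adicCompletion K)), ∀ x ∈ L,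
      W.rationalGaloisRepTate p (absGaloisRestrict K (v.adicCompletion K) τ) x ∈ L)
    (hχ : ∀ τ ∈ absInertia (v.adicCompletion K), ∀ x ∈ L,
      W.rationalGaloisRepTate p (absGaloisRestrict K (v.adicCompletion K) τ) x =
        (((GaloisRep.cyclotomicCharacter (v.adicCompletion K) p τ : ℤ_[p]ˣ) : ℤ_[p]) : ℚ_[p]) • x)
    (hquot : ∀ τ ∈ absInertia (v.adicCompletion K), ∀ x : W.rationalTateModule p,
      W.rationalGaloisRepTate p (absGaloisRestrict K (v.adicCompletion K) τ) x - x ∈ L) :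
    FramedGaloisRep.IsOrdinaryOfWeightAt p (W.framedTateGaloisRep p) v 2 1 := by
  sorry

/-- Sanity of the frame currency (rfl): the framed Tate representation restricted to `Γ_{K_v}` is
evaluated through `absGaloisRestrict`, exactly as in `hst`/`hχ`/`hquot`. [folklore] -/
example (σ : absoluteGaloisGroup (v.adicCompletion K)) :
    (W.framedTateGaloisRep p).toLocal v σ =
      W.framedTateGaloisRep p (absGaloisRestrict K (v.adicCompletion K) σ) :=
  FramedGaloisRep.toLocal_apply v _ σ

/-- Sanity (rfl): the representation framed by `framedTateGaloisRepOfBasis` is `W.rationalGaloisRepTate p`. -/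
example (h : Continuous fun x : absoluteGaloisGroup K × RationalTateModule (geomPoints W) p ↦
      rationalTateRepresentation (absoluteGaloisGroup K) (geomPoints W) p x.1 x.2)
    (σ : absoluteGaloisGroup K) :
    (rationalTateGaloisRepOf (geomPoints W) p h) σ = W.rationalGaloisRepTate p σ := rfl

end Frame

end Summit.ABC.ABC.Cruxes.FreyModularity.StubIdeas.LiftFive3g9
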